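import Summits.QuantumFields.YangMills.Theorems.PencilRigidityWeakCouplingHypercubicLimitStubSkewSeparatedOfLatticeFloor
import HarnessLib

/-!
# Stub `stub_disjointOfLatticeFloor` (N1) of line `Sketch`, crux `WeakCouplingHypercubicLimit` (reshape r15)

Helper file for crux `stmt-QuantumFields-16120` (`PencilRigidity.WeakCouplingHypercubicLimit`), line `Sketch`.
Reshape r15 relaxes the lattice core's third-cumulant floor from TIME-SEPARATED geometry to PAIRWISE-DISJOINT
geometry: a real triple `f, g, h` of pairwise disjoint topological supports and an eventual floor `δ ≤ |κ₃|`
for the LATTICE cumulant combination `κ₃ = S3 − S1·S2 − S1·S2 − S1·S2 + 2 S1 S1 S1` of the renormalised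
curvature field along the scheme.  This file is the lattice → continuum step: under the crux's convergence
clause (lattice `n`-point functions converge to the one-field family `S₁` on off-diagonal tensor witnesses of
complexified real tests), the floor passes to `S₁`, KEEPING the geometry: the complex tests `ofRealTest f,
ofRealTest g, ofRealTest h` have the same topological supports as `f, g, h`, the canonical tensor witnesses
`SchwartzMap.tensorFin` are off-diagonal by pairwise disjointness of supports, the seven instances
`n = 3, 2, 2, 2, 1, 1, 1` of the convergence clause pass `κ₃` to the limit, `δ ≤ ‖κ₃(S₁)‖`, hence
`κ₃(S₁) ≠ 0` on the canonical witnesses.  The proof re-runs that of the landed time-separated version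
`stub_skewSeparatedOfLatticeFloor` (reshape r12), with pairwise disjointness now a hypothesis rather than a
consequence of the half-space geometry.
-/

noncomputable section

open scoped SchwartzMap
open MeasureTheory Filter Topology
open Literature.MathematicalPhysics.AQFT Literature.MathematicalPhysics.QuantumLattice
open Literature.MathematicalPhysics.QuantumFieldTheory
open Summit.QuantumFields.YangMills.Cruxes.HypercubicLimit.CouplingResponse
open Summit.QuantumFields.YangMills.Theorems.OSLegsFromFemtoAndGap (isOffDiagonal_of_disjoint_three)

namespace Summit.QuantumFields.YangMills.Theorems.WeakCouplingHypercubicLimit.TraceNormColdPressure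

-- adapted from `stub_skewSeparatedOfLatticeFloor` (PencilRigidityWeakCouplingHypercubicLimitStubSkew
-- SeparatedOfLatticeFloor.lean): same witnesses and limit passage; pairwise disjointness is a hypothesis and
-- the conclusion is stated on the canonical witnesses `SchwartzMap.tensorFin`.
/-- **Stub N1 (a pairwise-disjoint lattice third-cumulant floor passes to the limit, keeping the geometry).**
Under the crux's convergence clause for the one-field family `S₁` of the renormalised curvature field, an
eventual floor `δ > 0` under the absolute value of the third-cumulant combination of LATTICE `n`-point
functions on one real triple `f, g, h` of pairwise disjoint topological supports yields complex tests
(namely `ofRealTest f, ofRealTest g, ofRealTest h`) of pairwise disjoint topological supports on which the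
continuum third-cumulant combination of `S₁`, evaluated on the canonical tensor witnesses
`SchwartzMap.tensorFin`, is non-zero: these witnesses are off-diagonal, so the lattice combination converges
to the continuum one, whose norm is then `≥ δ`. [folklore] -/
theorem stub_disjointOfLatticeFloor :
    ∀ (G : Type) [Group G] [TopologicalSpace G] [IsTopologicalGroup G] [CompactSpace G]
      [MeasurableSpace G] [BorelSpace G] (r : LatticeRep G) (sch : SpeciesScheme (YMSpecies G))
      (S₁ : SchwingerFamily (EuclideanSpace ℝ (Fin 4))),
      (∀ (n : ℕ), n ≠ 0 → ∀ (f : Fin n → 𝓢(EuclideanSpace ℝ (Fin 4), ℝ))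
        (F : 𝓢((Fin n → EuclideanSpace ℝ (Fin 4)), ℂ)), IsTensorOf F (fun i => ofRealTest (f i)) →
        IsOffDiagonal F →
          Tendsto (fun k : ℕ => ((latticeSchwinger r.ρ sch (fun s => s.F) k n (fun _ => r.curvature) f : ℝ) : ℂ))
            atTop (𝓝 (S₁ n F))) →
      (∃ (f g h : 𝓢(EuclideanSpace ℝ (Fin 4), ℝ)) (δ : ℝ),
        Disjoint (tsupport f) (tsupport g) ∧ Disjoint (tsupport f) (tsupport h) ∧
        Disjoint (tsupport g) (tsupport h) ∧ 0 < δ ∧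
        ∀ᶠ k in atTop, δ ≤
          |latticeSchwinger r.ρ sch (fun s => s.F) k 3 (fun _ => r.curvature) ![f, g, h] -
            latticeSchwinger r.ρ sch (fun s => s.F) k 1 (fun _ => r.curvature) ![f] *
              latticeSchwinger r.ρ sch (fun s => s.F) k 2 (fun _ => r.curvature) ![g, h] -
            latticeSchwinger r.ρ sch (fun s => s.F) k 1 (fun _ => r.curvature) ![g] *
              latticeSchwinger r.ρ sch (fun s => s.F) k 2 (fun _ => r.curvature) ![f, h] -
            latticeSchwinger r.ρ sch (fun s => s.F) k 1 (fun _ => r.curvature) ![h] *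
              latticeSchwinger r.ρ sch (fun s => s.F) k 2 (fun _ => r.curvature) ![f, g] +
            2 * (latticeSchwinger r.ρ sch (fun s => s.F) k 1 (fun _ => r.curvature) ![f] *
              latticeSchwinger r.ρ sch (fun s => s.F) k 1 (fun _ => r.curvature) ![g] *
              latticeSchwinger r.ρ sch (fun s => s.F) k 1 (fun _ => r.curvature) ![h])|) →
      ∃ (f g h : 𝓢(EuclideanSpace ℝ (Fin 4), ℂ)),
        Disjoint (tsupport (f : EuclideanSpace ℝ (Fin 4) → ℂ)) (tsupport (g : EuclideanSpace ℝ (Fin 4) → ℂ)) ∧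
        Disjoint (tsupport (f : EuclideanSpace ℝ (Fin 4) → ℂ)) (tsupport (h : EuclideanSpace ℝ (Fin 4) → ℂ)) ∧
        Disjoint (tsupport (g : EuclideanSpace ℝ (Fin 4) → ℂ)) (tsupport (h : EuclideanSpace ℝ (Fin 4) → ℂ)) ∧
        S₁ 3 (SchwartzMap.tensorFin 3 ![f, g, h]) -
            S₁ 1 (SchwartzMap.tensorFin 1 ![f]) * S₁ 2 (SchwartzMap.tensorFin 2 ![g, h]) -
          S₁ 1 (SchwartzMap.tensorFin 1 ![g]) * S₁ 2 (SchwartzMap.tensorFin 2 ![f, h]) -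
          S₁ 1 (SchwartzMap.tensorFin 1 ![h]) * S₁ 2 (SchwartzMap.tensorFin 2 ![f, g]) +
          2 * (S₁ 1 (SchwartzMap.tensorFin 1 ![f]) * S₁ 1 (SchwartzMap.tensorFin 1 ![g]) *
            S₁ 1 (SchwartzMap.tensorFin 1 ![h])) ≠ 0 := by
  intro G _ _ _ _ _ _ r sch S₁ hconv hfloor
  obtain ⟨f, g, h, δ, hfg, hfh, hgh, hδ, hev⟩ := hfloor
  -- complexification does not change the topological support
  have hsupp : ∀ u : 𝓢(EuclideanSpace ℝ (Fin 4), ℝ),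
      tsupport (ofRealTest u : EuclideanSpace ℝ (Fin 4) → ℂ) = tsupport (u : EuclideanSpace ℝ (Fin 4) → ℝ) := by
    intro u
    unfold tsupport
    congr 1
    ext x
    simp [Function.mem_support, ofRealTest_apply]
  have hfg' : Disjoint (tsupport (ofRealTest f : EuclideanSpace ℝ (Fin 4) → ℂ))
      (tsupport (ofRealTest g : EuclideanSpace ℝ (Fin 4) → ℂ)) := by
    rw [hsupp, hsupp]; exact hfg
  have hfh' : Disjoint (tsupport (ofRealTest f : EuclideanSpace ℝ (Fin 4) → ℂ))
      (tsupport (ofRealTest h : EuclideanSpace ℝ (Fin 4) → ℂ)) := by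
    rw [hsupp, hsupp]; exact hfh
  have hgh' : Disjoint (tsupport (ofRealTest g : EuclideanSpace ℝ (Fin 4) → ℂ))
      (tsupport (ofRealTest h : EuclideanSpace ℝ (Fin 4) → ℂ)) := by
    rw [hsupp, hsupp]; exact hgh
  -- the canonical tensor witnesses
  set T3 : 𝓢((Fin 3 → EuclideanSpace ℝ (Fin 4)), ℂ) :=
    SchwartzMap.tensorFin 3 ![ofRealTest f, ofRealTest g, ofRealTest h]
  set Tgh : 𝓢((Fin 2 → EuclideanSpace ℝ (Fin 4)), ℂ) := SchwartzMap.tensorFin 2 ![ofRealTest g, ofRealTest h]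
  set Tfh : 𝓢((Fin 2 → EuclideanSpace ℝ (Fin 4)), ℂ) := SchwartzMap.tensorFin 2 ![ofRealTest f, ofRealTest h]
  set Tfg : 𝓢((Fin 2 → EuclideanSpace ℝ (Fin 4)), ℂ) := SchwartzMap.tensorFin 2 ![ofRealTest f, ofRealTest g]
  set Tf : 𝓢((Fin 1 → EuclideanSpace ℝ (Fin 4)), ℂ) := SchwartzMap.tensorFin 1 ![ofRealTest f]
  set Tg : 𝓢((Fin 1 → EuclideanSpace ℝ (Fin 4)), ℂ) := SchwartzMap.tensorFin 1 ![ofRealTest g]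
  set Th : 𝓢((Fin 1 → EuclideanSpace ℝ (Fin 4)), ℂ) := SchwartzMap.tensorFin 1 ![ofRealTest h]
  have hT3 : IsTensorOf T3 ![ofRealTest f, ofRealTest g, ofRealTest h] := isTensorOf_tensorFin _
  have hTgh : IsTensorOf Tgh ![ofRealTest g, ofRealTest h] := isTensorOf_tensorFin _
  have hTfh : IsTensorOf Tfh ![ofRealTest f, ofRealTest h] := isTensorOf_tensorFin _
  have hTfg : IsTensorOf Tfg ![ofRealTest f, ofRealTest g] := isTensorOf_tensorFin _
  have hTf : IsTensorOf Tf ![ofRealTest f] := isTensorOf_tensorFin _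
  have hTg : IsTensorOf Tg ![ofRealTest g] := isTensorOf_tensorFin _
  have hTh : IsTensorOf Th ![ofRealTest h] := isTensorOf_tensorFin _
  -- the same witnesses in the shape `fun i => ofRealTest (![…] i)` of the convergence clause
  have e3 : ∀ a b c : 𝓢(EuclideanSpace ℝ (Fin 4), ℝ),
      (fun i => ofRealTest (![a, b, c] i)) = ![ofRealTest a, ofRealTest b, ofRealTest c] := by
    intro a b c; funext i; fin_cases i <;> rfl
  have e2 : ∀ a b : 𝓢(EuclideanSpace ℝ (Fin 4), ℝ),
      (fun i => ofRealTest (![a, b] i)) = ![ofRealTest a, ofRealTest b] := by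
    intro a b; funext i; fin_cases i <;> rfl
  have e1 : ∀ a : 𝓢(EuclideanSpace ℝ (Fin 4), ℝ), (fun i => ofRealTest (![a] i)) = ![ofRealTest a] := by
    intro a; funext i; fin_cases i; rfl
  -- off-diagonality from pairwise disjoint supports; arity 1 is automatic (no distinct indices in `Fin 1`)
  have hod1 : ∀ F : 𝓢((Fin 1 → EuclideanSpace ℝ (Fin 4)), ℂ), IsOffDiagonal F := by
    rintro F x ⟨i, j, hij, -⟩
    exact absurd (Subsingleton.elim i j) hij
  have hod3 : IsOffDiagonal T3 := isOffDiagonal_of_disjoint_three hfg hgh hfh hT3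
  have hodgh : IsOffDiagonal Tgh := isOffDiagonal_of_disjoint_two hgh hTgh
  have hodfh : IsOffDiagonal Tfh := isOffDiagonal_of_disjoint_two hfh hTfh
  have hodfg : IsOffDiagonal Tfg := isOffDiagonal_of_disjoint_two hfg hTfg
  -- the seven instances of the convergence clause
  have c3 := hconv 3 (by norm_num) ![f, g, h] T3 ((e3 f g h).symm ▸ hT3) hod3
  have cgh := hconv 2 two_ne_zero ![g, h] Tgh ((e2 g h).symm ▸ hTgh) hodgh
  have cfh := hconv 2 two_ne_zero ![f, h] Tfh ((e2 f h).symm ▸ hTfh) hodfh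
  have cfg := hconv 2 two_ne_zero ![f, g] Tfg ((e2 f g).symm ▸ hTfg) hodfg
  have cf := hconv 1 one_ne_zero ![f] Tf ((e1 f).symm ▸ hTf) (hod1 _)
  have cg := hconv 1 one_ne_zero ![g] Tg ((e1 g).symm ▸ hTg) (hod1 _)
  have ch := hconv 1 one_ne_zero ![h] Th ((e1 h).symm ▸ hTh) (hod1 _)
  refine ⟨ofRealTest f, ofRealTest g, ofRealTest h, hfg', hfh', hgh', ?_⟩
  show S₁ 3 T3 - S₁ 1 Tf * S₁ 2 Tgh - S₁ 1 Tg * S₁ 2 Tfh - S₁ 1 Th * S₁ 2 Tfg + 2 * (S₁ 1 Tf * S₁ 1 Tg * S₁ 1 Th) ≠ 0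
  -- the lattice cumulant combination converges to the continuum one
  have hT : Tendsto (fun k : ℕ =>
      ((latticeSchwinger r.ρ sch (fun s => s.F) k 3 (fun _ => r.curvature) ![f, g, h] -
        latticeSchwinger r.ρ sch (fun s => s.F) k 1 (fun _ => r.curvature) ![f] *
          latticeSchwinger r.ρ sch (fun s => s.F) k 2 (fun _ => r.curvature) ![g, h] -
        latticeSchwinger r.ρ sch (fun s => s.F) k 1 (fun _ => r.curvature) ![g] *
          latticeSchwinger r.ρ sch (fun s => s.F) k 2 (fun _ => r.curvature) ![f, h] -
        latticeSchwinger r.ρ sch (fun s => s.F) k 1 (fun _ => r.curvature) ![h] *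
          latticeSchwinger r.ρ sch (fun s => s.F) k 2 (fun _ => r.curvature) ![f, g] +
        2 * (latticeSchwinger r.ρ sch (fun s => s.F) k 1 (fun _ => r.curvature) ![f] *
          latticeSchwinger r.ρ sch (fun s => s.F) k 1 (fun _ => r.curvature) ![g] *
            latticeSchwinger r.ρ sch (fun s => s.F) k 1 (fun _ => r.curvature) ![h]) : ℝ) : ℂ)) atTop
      (𝓝 (S₁ 3 T3 - S₁ 1 Tf * S₁ 2 Tgh - S₁ 1 Tg * S₁ 2 Tfh - S₁ 1 Th * S₁ 2 Tfg +
        2 * (S₁ 1 Tf * S₁ 1 Tg * S₁ 1 Th))) :=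
    ((((c3.sub (cf.mul cgh)).sub (cg.mul cfh)).sub (ch.mul cfg)).add
      (((cf.mul cg).mul ch).const_mul 2)).congr fun k => by push_cast; ring
  -- hence so do the absolute values, and the floor passes to the limit
  have hN : Tendsto (fun k : ℕ =>
      |latticeSchwinger r.ρ sch (fun s => s.F) k 3 (fun _ => r.curvature) ![f, g, h] -
        latticeSchwinger r.ρ sch (fun s => s.F) k 1 (fun _ => r.curvature) ![f] *
          latticeSchwinger r.ρ sch (fun s => s.F) k 2 (fun _ => r.curvature) ![g, h] -
        latticeSchwinger r.ρ sch (fun s => s.F) k 1 (fun _ => r.curvature) ![g] *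
          latticeSchwinger r.ρ sch (fun s => s.F) k 2 (fun _ => r.curvature) ![f, h] -
        latticeSchwinger r.ρ sch (fun s => s.F) k 1 (fun _ => r.curvature) ![h] *
          latticeSchwinger r.ρ sch (fun s => s.F) k 2 (fun _ => r.curvature) ![f, g] +
        2 * (latticeSchwinger r.ρ sch (fun s => s.F) k 1 (fun _ => r.curvature) ![f] *
          latticeSchwinger r.ρ sch (fun s => s.F) k 1 (fun _ => r.curvature) ![g] *
            latticeSchwinger r.ρ sch (fun s => s.F) k 1 (fun _ => r.curvature) ![h])|) atTop
      (𝓝 ‖S₁ 3 T3 - S₁ 1 Tf * S₁ 2 Tgh - S₁ 1 Tg * S₁ 2 Tfh - S₁ 1 Th * S₁ 2 Tfg +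
        2 * (S₁ 1 Tf * S₁ 1 Tg * S₁ 1 Th)‖) := by
    simpa only [Complex.norm_real, Real.norm_eq_abs] using hT.norm
  have hge : δ ≤ ‖S₁ 3 T3 - S₁ 1 Tf * S₁ 2 Tgh - S₁ 1 Tg * S₁ 2 Tfh - S₁ 1 Th * S₁ 2 Tfg +
      2 * (S₁ 1 Tf * S₁ 1 Tg * S₁ 1 Th)‖ :=
    ge_of_tendsto hN hev
  intro h0
  rw [h0, norm_zero] at hge
  exact absurd hge (not_le.2 hδ)

end Summit.QuantumFields.YangMills.Theorems.WeakCouplingHypercubicLimit.TraceNormColdPressure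

end
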